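import Literature.AlgebraicGeometry.ShimuraVarieties.UnitaryBallClassLiftTranslate
import Literature.AlgebraicGeometry.HodgeTheory.HodgeModelTopFormOfClass
import Literature.AlgebraicGeometry.HodgeTheory.HolomorphicTopFormClassesBijective
import HarnessLib

/-!
# The holomorphic top form of a class along a Hecke translation is the translated top form

Topic `AlgebraicGeometry/ShimuraVarieties`; namespace
`Literature.AlgebraicGeometry.ShimuraVarieties.UnitaryBallUniformisationDatum` (continues `UnitaryBallClassLiftTranslate`,
the DEGREE-TWO companion of its `classLift_pull_mulVec` / of `UnitaryBallHolomorphicLift.classLift_pull`).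
Reproduction (kernel): theorems only, no records, no new hypotheses beyond those of the inputs joined.

Let `X`, `X'` be compact ball quotient surfaces with uniformization data `D`, `D'` (`UnitaryBallUniformisationDatum 2`),
read in Hodge models `A`, `A'`, and let `f : X' ⟶ X` be a morphism INTERTWINING THE UNIFORMIZATIONS UP TO AN ISOMETRY
`g ∈ U(H^{τ₁}) = D.realPoints`: `f(ℂ) (unif' v) = unif (g v)` on the negative cone (the Hecke translation of a rational
isometry, `g = γ^{τ₁}`; the level covering is `g = 1`).  Give `D'` the frame matrix of a Sylvester frame `𝔣` of `D`
(`𝔣'.t = 𝔣.t`) and let `ĝ := D.frameIso 𝔣 g = T⁻¹ g T ∈ U(2,1)`.  Then: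

* `formPullback₂_pullback_anMap_mulVec` — for a `ℂ`-bilinear `2`-form `β` on `X^an`,
  `formPullback₂' ((f^an)^* β) (z) = det J(ĝ, z) · formPullback₂ β (ĝ z)`: the pull-back of `(f^an)^*β` to the ball
  through `ψ'` is the TRANSLATE `ĝ^*` of the pull-back of `β` through `ψ` for the canonical factor `det J`
  (chain rule `d(f^an) ∘ dψ' = dψ ∘ J(ĝ, ·)` of `UnitaryBallClassLiftTranslate` + bilinearity, Borel §5.14);
* **`formPullback₂_topFormOfClass_pull_mulVec`** — for `x ∈ F²H²(X)` (the `(2,0)`-classes), **the holomorphic top form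
  of `f^* x` (computed on `X'`, standard model) pulls back to the ball as `z ↦ det J(ĝ, z) · F_x(ĝ z)`**, `F_x` the ball
  function of the holomorphic top form of `x`: the holomorphic representative of `f^*x` is `(f^an)^* α_x` (GAGA: `f^an`
  is holomorphic, so `(f^an)^*α_x` is a closed `(2,0)`-form, i.e. a holomorphic top form
  (`mem_holFormsInCharts_of_isClosedForm_of_isOfType_top`), with class `(f^an)^*[α_x] = Θ'(f^*x)` by naturality of
  the de Rham comparison of the standard model and of `Θ`; uniqueness of holomorphic representatives,
  `HodgeModel.eq_topFormOfClass_of_topHolFormClass_eq`, Voisin I Cor. 7.6) — verbatim the argument of `classLift_pull`;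
* `formPullback₂_topFormOfClass_pull` — the level-covering case `g = 1`: the two ball functions are EQUAL.

Consumer: the level-meeting field of the automorphic dictionary of the Picard modular tower (pub-hodgecm2, Transposition
item (iii)): the adelic lift of `cover^* x` / of a Hecke translate of `x` is read off the lift of `x`.

References: A. Borel, *Automorphic forms on SL₂(ℝ)* (1997), §5.14; C. Voisin, *Hodge Theory and Complex Algebraic
Geometry I* (2002), §2.2.1, §7.1.1 Cor. 7.6, §7.3.2; J.-P. Serre, GAGA, Ann. Inst. Fourier 6 (1956), §2 n°5;
G. Shimura, *Introduction to the arithmetic theory of automorphic functions* (1971), §7.2–7.3.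
-/

noncomputable section

open Matrix MulAction Function Set Filter
open scoped Manifold ContDiff Topology TensorProduct
open CategoryTheory
open Literature.Geometry.ComplexHyperbolic
open Literature.Geometry.ComplexHyperbolic.BallModel (U21 Ball Jac nsq actVec)
open Literature.Geometry.Kaehler (MForm IsHolomorphicInCharts holFormsInCharts holFormsInChartsToClosed
  isOfType_of_mem isHolomorphicInCharts_of_mem isSmoothForm_of_mem)
open Literature.NumberTheory.Transcendental
open Literature.AlgebraicTopology.SingularHomology
open Literature.AlgebraicGeometry.HodgeTheory
open Literature.AlgebraicGeometry.Motives (bettiCohomology ofRatClassBaseChange)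

namespace Literature.AlgebraicGeometry.ShimuraVarieties

namespace UnitaryBallUniformisationDatum

variable {X : Motives.SchemeOver ℂ} (D : UnitaryBallUniformisationDatum 2 X)

/-! ### The pull-back of a `2`-form along `f^an`, read on the ball -/

section Translate

variable {X' : Motives.SchemeOver ℂ} (D' : UnitaryBallUniformisationDatum 2 X') (A : HodgeModel 2 X)
  (A' : HodgeModel 2 X') (f : X' ⟶ X) (𝔣 : D.SylvesterFrame) (𝔣' : D'.SylvesterFrame)

/-- **The pull-back of `(f^an)^* β` to the ball is the canonical translate by `ĝ` of the pull-back of `β`**: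
`formPullback₂' ((f^an)^* β) (z) = det J(ĝ, z) · formPullback₂ β (ĝ z)` for a `ℂ`-bilinear `2`-form `β` on `X^an`
(chain rule `d(f^an)_{ψ' z} ∘ dψ'_z = dψ_{ĝ z} ∘ J(ĝ, z)`, `ℂ`-linearity of `dψ`, bilinearity and alternation of `β`).
[cite: Borel1997, §5.14] [cite: VoisinHodgeI2002, §2.2.1] -/
theorem formPullback₂_pullback_anMap_mulVec (hX : Motives.IsSmoothProjective 2 X)
    (hX' : Motives.IsSmoothProjective 2 X') (hT : 𝔣'.t = 𝔣.t) {g : GL (Fin 3) ℂ} (hg : g ∈ D.realPoints)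
    (hf : ∀ v ∈ D'.cone, Motives.AlgPoints.map f (D'.unif v) = D.unif ((g : Matrix (Fin 3) (Fin 3) ℂ) *ᵥ v))
    {β : MForm 𝓘(ℝ, A.model) A.carrier ℂ 2} (hβ : IsComplexLinearForm β) (z : Ball) :
    D'.formPullback₂ A' 𝔣' (β.pullback 𝓘(ℝ, A'.model) (HodgeModel.anMap A A' f)) z =
      (Jac (D.frameIso 𝔣 ⟨g, hg⟩) z).det * D.formPullback₂ A 𝔣 β (D.frameIso 𝔣 ⟨g, hg⟩ • z) := by
  have key : ∀ {x y : A.carrier}, x = y → ∀ u v : A.model, β x ![u, v] = β y ![u, v] := by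
    intro x y h u v
    subst h
    rfl
  rw [formPullback₂_apply, MForm.pullback_apply]
  have hcomp : ∀ w : Fin 2 → ℂ,
      (mfderiv 𝓘(ℝ, A'.model) 𝓘(ℝ, A.model) (HodgeModel.anMap A A' f) (D'.modelUnif A' 𝔣' z.1))
          (D'.unifDeriv A' 𝔣' z.1 w) =
        D.unifDeriv A 𝔣 (D.frameIso 𝔣 ⟨g, hg⟩ • z).1 (Jac (D.frameIso 𝔣 ⟨g, hg⟩) z *ᵥ w) := fun w ↦ by
    have h := congrArg (fun φ : (Fin 2 → ℂ) →L[ℝ] A.model ↦ φ w)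
      (D.mfderiv_anMap_comp_unifDeriv_mulVec D' A A' f 𝔣 𝔣' hX hX' hT hg hf z)
    simp only [ContinuousLinearMap.comp_apply, jacCLM_apply] at h
    exact h
  have hvec : (fun i : Fin 2 ↦ (mfderiv 𝓘(ℝ, A'.model) 𝓘(ℝ, A.model) (HodgeModel.anMap A A' f)
      (D'.modelUnif A' 𝔣' z.1)) (![D'.unifDeriv A' 𝔣' z.1 (Pi.single 0 1),
        D'.unifDeriv A' 𝔣' z.1 (Pi.single 1 1)] i)) =
      ![D.unifDeriv A 𝔣 (D.frameIso 𝔣 ⟨g, hg⟩ • z).1 (Jac (D.frameIso 𝔣 ⟨g, hg⟩) z *ᵥ Pi.single 0 1),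
        D.unifDeriv A 𝔣 (D.frameIso 𝔣 ⟨g, hg⟩ • z).1 (Jac (D.frameIso 𝔣 ⟨g, hg⟩) z *ᵥ Pi.single 1 1)] := by
    funext i
    fin_cases i
    · exact hcomp _
    · exact hcomp _
  refine ((congrArg (β _) hvec).trans (key (D.anMap_modelUnif_mulVec D' A A' f 𝔣 𝔣' hT hg hf z) _ _)).trans ?_
  -- the two columns of the Jacobian, read through the `ℂ`-linear differential `dψ`
  have hcol : ∀ i : Fin 2,
      D.unifDeriv A 𝔣 (D.frameIso 𝔣 ⟨g, hg⟩ • z).1 (Jac (D.frameIso 𝔣 ⟨g, hg⟩) z *ᵥ Pi.single i 1) =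
        Jac (D.frameIso 𝔣 ⟨g, hg⟩) z 0 i • D.unifDeriv A 𝔣 (D.frameIso 𝔣 ⟨g, hg⟩ • z).1 (Pi.single 0 1) +
          Jac (D.frameIso 𝔣 ⟨g, hg⟩) z 1 i • D.unifDeriv A 𝔣 (D.frameIso 𝔣 ⟨g, hg⟩ • z).1 (Pi.single 1 1) :=
    fun i ↦ by rw [jac_mulVec_single, map_add, unifDeriv_smul, unifDeriv_smul]
  have hvec2 :
      (![D.unifDeriv A 𝔣 (D.frameIso 𝔣 ⟨g, hg⟩ • z).1 (Jac (D.frameIso 𝔣 ⟨g, hg⟩) z *ᵥ Pi.single 0 1),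
          D.unifDeriv A 𝔣 (D.frameIso 𝔣 ⟨g, hg⟩ • z).1 (Jac (D.frameIso 𝔣 ⟨g, hg⟩) z *ᵥ Pi.single 1 1)] :
          Fin 2 → A.model) =
        ![Jac (D.frameIso 𝔣 ⟨g, hg⟩) z 0 0 • D.unifDeriv A 𝔣 (D.frameIso 𝔣 ⟨g, hg⟩ • z).1 (Pi.single 0 1) +
            Jac (D.frameIso 𝔣 ⟨g, hg⟩) z 1 0 • D.unifDeriv A 𝔣 (D.frameIso 𝔣 ⟨g, hg⟩ • z).1 (Pi.single 1 1),
          Jac (D.frameIso 𝔣 ⟨g, hg⟩) z 0 1 • D.unifDeriv A 𝔣 (D.frameIso 𝔣 ⟨g, hg⟩ • z).1 (Pi.single 0 1) +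
            Jac (D.frameIso 𝔣 ⟨g, hg⟩) z 1 1 • D.unifDeriv A 𝔣 (D.frameIso 𝔣 ⟨g, hg⟩ • z).1 (Pi.single 1 1)] := by
    rw [hcol 0, hcol 1]
  refine (congrArg (β _) hvec2).trans ?_
  refine (mform₂_apply_lincomb hβ _ _ _ _ _ _ _).trans ?_
  rw [formPullback₂_apply, Matrix.det_fin_two]
  ring

/-- The LEVEL-COVERING case `g = 1` of `formPullback₂_pullback_anMap_mulVec`: `formPullback₂' ((f^an)^* β) = formPullback₂ β`
(same frame matrix, `f(ℂ) ∘ unif' = unif`). [cite: Borel1997, §5.14] [cite: VoisinHodgeI2002, §2.2.1] -/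
theorem formPullback₂_pullback_anMap (hX : Motives.IsSmoothProjective 2 X)
    (hX' : Motives.IsSmoothProjective 2 X') (hT : 𝔣'.t = 𝔣.t)
    (hf : ∀ v ∈ D'.cone, Motives.AlgPoints.map f (D'.unif v) = D.unif v)
    (β : MForm 𝓘(ℝ, A.model) A.carrier ℂ 2) (z : Ball) :
    D'.formPullback₂ A' 𝔣' (β.pullback 𝓘(ℝ, A'.model) (HodgeModel.anMap A A' f)) z = D.formPullback₂ A 𝔣 β z := by
  have key : ∀ {x y : A.carrier}, x = y → ∀ u v : A.model, β x ![u, v] = β y ![u, v] := by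
    intro x y h u v
    subst h
    rfl
  rw [formPullback₂_apply, MForm.pullback_apply, formPullback₂_apply]
  have hcomp : ∀ w : Fin 2 → ℂ,
      (mfderiv 𝓘(ℝ, A'.model) 𝓘(ℝ, A.model) (HodgeModel.anMap A A' f) (D'.modelUnif A' 𝔣' z.1))
          (D'.unifDeriv A' 𝔣' z.1 w) = D.unifDeriv A 𝔣 z.1 w := fun w ↦ by
    exact (congrArg (fun φ : (Fin 2 → ℂ) →L[ℝ] A.model ↦ φ w)
      (D.unifDeriv_eq_mfderiv_anMap_comp D' A A' f 𝔣 𝔣' hX hX' hT hf z)).symm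
  have hvec : (fun i : Fin 2 ↦ (mfderiv 𝓘(ℝ, A'.model) 𝓘(ℝ, A.model) (HodgeModel.anMap A A' f)
      (D'.modelUnif A' 𝔣' z.1)) (![D'.unifDeriv A' 𝔣' z.1 (Pi.single 0 1),
        D'.unifDeriv A' 𝔣' z.1 (Pi.single 1 1)] i)) =
      ![D.unifDeriv A 𝔣 z.1 (Pi.single 0 1), D.unifDeriv A 𝔣 z.1 (Pi.single 1 1)] := by
    funext i
    fin_cases i
    · exact hcomp _
    · exact hcomp _
  exact (congrArg (β _) hvec).trans (key (D.anMap_modelUnif D' A A' f 𝔣 𝔣' hT hf z) _ _)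

end Translate

/-! ### The holomorphic top form of a class along a Hecke translation / a level covering -/

section TopForm

/-- **(translate, degree two) Compatibility of the holomorphic top form with Hecke translations.** Let `f : X' ⟶ X` be a
morphism of ball quotient surfaces with `f(ℂ) (unif' v) = unif (g v)` on the cone for an isometry `g ∈ U(H^{τ₁})`, and give
`D'` the frame matrix of `𝔣`.  Then for `x ∈ F²H²(X)` the ball function of the holomorphic top form of `f^* x` (standard
model of `X'`) is the canonical translate by `ĝ = T⁻¹ g T ∈ U(2,1)` of that of `x`:
`F'_{f^*x}(z) = det J(ĝ, z) · F_x(ĝ z)`.  The holomorphic representative of `f^*x` is `(f^an)^* α_x` (GAGA: `f^an` is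
holomorphic; a closed `(2,0)`-form on a surface is a holomorphic top form; its class is `(f^an)^*[α_x] = Θ'(f^*x)` by
naturality of the standard de Rham family and of `Θ`; uniqueness of holomorphic representatives, Voisin I Cor. 7.6), and
`f^an ∘ ψ' = ψ ∘ ĝ` on the ball. [cite: Shimura1973, §7.2–7.3] [cite: Borel1997, §5.14]
[cite: VoisinHodgeI2002, §7.1.1 Cor. 7.6 and §7.3.2] [cite: SerreGAGA1956, §2 n°5 (fonctorialité)] -/
theorem formPullback₂_topFormOfClass_pull_mulVec (hHD : exists_isReal_hodgeModel) (𝔣 : D.SylvesterFrame)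
    (hI : hodgePQ_independent_of_hodgeModel) {X' : Motives.SchemeOver ℂ}
    (D' : UnitaryBallUniformisationDatum 2 X') (𝔣' : D'.SylvesterFrame) (f : X' ⟶ X) (hT : 𝔣'.t = 𝔣.t)
    {g : GL (Fin 3) ℂ} (hg : g ∈ D.realPoints)
    (hf : ∀ v ∈ D'.cone, Motives.AlgPoints.map f (D'.unif v) = D.unif ((g : Matrix (Fin 3) (Fin 3) ℂ) *ᵥ v))
    {hX : Motives.IsSmoothProjective 2 X} (hX' : Motives.IsSmoothProjective 2 X')
    {x : ℂ ⊗[ℚ] bettiCohomology X 2} (hx : x ∈ (BettiUniverse.hodge hHD hX 2).F 2) :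
    D'.formPullback₂ (stdModel hHD hX') 𝔣'
        ((stdModel hHD hX').topFormOfClass hX' ((stdModel hHD hX').topHolFormClassPQ_bijective hX')
          ((BettiUniverse.pull f 2).baseChange ℂ x) :
          MForm 𝓘(ℝ, Fin 2 → ℂ) (stdCarrier hX').carrier ℂ 2) =
      fun z ↦ (Jac (D.frameIso 𝔣 ⟨g, hg⟩) z).det *
        D.formPullback₂ (stdModel hHD hX) 𝔣
          ((stdModel hHD hX).topFormOfClass hX ((stdModel hHD hX).topHolFormClassPQ_bijective hX) x :
            MForm 𝓘(ℝ, Fin 2 → ℂ) (stdCarrier hX).carrier ℂ 2) (D.frameIso 𝔣 ⟨g, hg⟩ • z) := by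
  set A := stdModel hHD hX with hA
  set A' := stdModel hHD hX' with hA'
  haveI : CompleteSpace (Fin 2 → ℂ) := FiniteDimensional.complete ℂ (Fin 2 → ℂ)
  have hcl : A.HolFormsClosed 2 := A.holFormsClosed_top
  have hcl' : A'.HolFormsClosed 2 := A'.holFormsClosed_top
  have hxp : x ∈ A.ratPiece hX 2 2 0 := mem_ratPiece_stdModel_of_mem_hodge_F hHD hI hX hx
  set α := A.topFormOfClass hX (A.topHolFormClassPQ_bijective hX) x with hαdef
  -- the analytified morphism and the pulled-back form
  set φ : A'.carrier → A.carrier := HodgeModel.anMap A A' f with hφdef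
  have hφ' : MDifferentiable 𝓘(ℂ, Fin 2 → ℂ) 𝓘(ℂ, Fin 2 → ℂ) φ :=
    HodgeModel.mdifferentiable_anMap A A' f hX' hX
  have hφ : ContMDiff 𝓘(ℝ, Fin 2 → ℂ) 𝓘(ℝ, Fin 2 → ℂ) ∞ φ := hφ'.contMDiff_real_of_complex
  set β : MForm 𝓘(ℝ, Fin 2 → ℂ) A'.carrier ℂ 2 :=
    (α : MForm 𝓘(ℝ, Fin 2 → ℂ) A.carrier ℂ 2).pullback 𝓘(ℝ, Fin 2 → ℂ) φ with hβdef
  have hβc : β ∈ cclosedSmoothForms (Fin 2 → ℂ) A'.carrier 2 :=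
    pullback_mem_cclosedSmoothForms hφ (hcl α)
  have hβt : IsOfType 2 0 β := (isOfType_of_mem α).pullback hφ'
  have hn : Module.finrank ℂ (Fin 2 → ℂ) = 2 := by simp
  have hβh : β ∈ holFormsInCharts (Fin 2 → ℂ) A'.carrier 2 :=
    mem_holFormsInCharts_of_isClosedForm_of_isOfType_top hn
      ((mem_cclosedSmoothForms_iff β).1 hβc).1 ((mem_cclosedSmoothForms_iff β).1 hβc).2 hβt
  -- its class is `Θ'(f^* x)`
  have hclassβ : A'.topHolFormClass ⟨β, hβh⟩ =
      A'.complexification hX' 2 ((BettiUniverse.pull f 2).baseChange ℂ x) := by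
    rw [HodgeModel.topHolFormClass_apply]
    have hmk : complexDeRhamCohomology.mk (Fin 2 → ℂ) A'.carrier 2
          (holFormsInChartsToClosed A'.finrank_model ⟨β, hβh⟩) =
        complexDeRhamCohomology.map (Fin 2 → ℂ) hφ 2
          (complexDeRhamCohomology.mk (Fin 2 → ℂ) A.carrier 2 (holFormsInChartsToClosed A.finrank_model α)) := by
      rw [complexDeRhamCohomology.map_mk]
      congr 1
    rw [hmk, A'.deRham_isNatural A'.carrier A.carrier φ hφ 2]
    have hΘ : A'.deRham A.carrier 2 (complexDeRhamCohomology.mk (Fin 2 → ℂ) A.carrier 2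
        (holFormsInChartsToClosed A.finrank_model α)) = A.complexification hX 2 x := by
      rw [← A.topHolFormClass_topFormOfClass_of_mem_ratPiece hX (A.topHolFormClassPQ_bijective hX) hxp,
        HodgeModel.topHolFormClass_apply]
    rw [hΘ, HodgeModel.complexification_apply, HodgeModel.complexification_apply]
    have hnat := HodgeModel.map_anMap_pullback A A' f 2
      (ofRatClassBaseChange (Motives.ComplexPoints X) 2 x)
    rw [map_ofRatClassBaseChange _ 2 (Motives.AlgPoints.mapContinuous (L := ℂ) f)] at hnat
    exact hnat
  -- hence it IS the holomorphic representative of `f^* x`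
  have hβeq : (⟨β, hβh⟩ : holFormsInCharts (Fin 2 → ℂ) A'.carrier 2) =
      A'.topFormOfClass hX' (A'.topHolFormClassPQ_bijective hX') ((BettiUniverse.pull f 2).baseChange ℂ x) :=
    A'.eq_topFormOfClass_of_topHolFormClass_eq hX' (A'.topHolFormClassPQ_bijective hX') hclassβ
  -- and the ball functions agree up to the canonical translate
  rw [← hβeq]
  funext z
  exact D.formPullback₂_pullback_anMap_mulVec D' A A' f 𝔣 𝔣' hX hX' hT hg hf
    (isOfType_of_mem α).isComplexLinearForm z

/-- **(saturate, degree two) Compatibility of the holomorphic top form with level coverings** (`g = 1`): for a morphism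
`f : X' ⟶ X` with `f(ℂ) ∘ unif' = unif` on the cone and equal frame matrices, and `x ∈ F²H²(X)`, the ball function of the
holomorphic top form of `f^* x` IS that of `x`. [cite: Borel1997, §5.14] [cite: VoisinHodgeI2002, §7.1.1 Cor. 7.6 and §7.3.2]
[cite: SerreGAGA1956, §2 n°5 (fonctorialité)] [cite: BergeronMillsonMoeglin2016Balls, Introduction §1.1] -/
theorem formPullback₂_topFormOfClass_pull (hHD : exists_isReal_hodgeModel) (𝔣 : D.SylvesterFrame)
    (hI : hodgePQ_independent_of_hodgeModel) {X' : Motives.SchemeOver ℂ}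
    (D' : UnitaryBallUniformisationDatum 2 X') (𝔣' : D'.SylvesterFrame) (f : X' ⟶ X) (hT : 𝔣'.t = 𝔣.t)
    (hf : ∀ v ∈ D'.cone, Motives.AlgPoints.map f (D'.unif v) = D.unif v)
    {hX : Motives.IsSmoothProjective 2 X} (hX' : Motives.IsSmoothProjective 2 X')
    {x : ℂ ⊗[ℚ] bettiCohomology X 2} (hx : x ∈ (BettiUniverse.hodge hHD hX 2).F 2) :
    D'.formPullback₂ (stdModel hHD hX') 𝔣'
        ((stdModel hHD hX').topFormOfClass hX' ((stdModel hHD hX').topHolFormClassPQ_bijective hX')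
          ((BettiUniverse.pull f 2).baseChange ℂ x) :
          MForm 𝓘(ℝ, Fin 2 → ℂ) (stdCarrier hX').carrier ℂ 2) =
      D.formPullback₂ (stdModel hHD hX) 𝔣
        ((stdModel hHD hX).topFormOfClass hX ((stdModel hHD hX).topHolFormClassPQ_bijective hX) x :
          MForm 𝓘(ℝ, Fin 2 → ℂ) (stdCarrier hX).carrier ℂ 2) := by
  have hf' : ∀ v ∈ D'.cone, Motives.AlgPoints.map f (D'.unif v) =
      D.unif (((1 : GL (Fin 3) ℂ) : Matrix (Fin 3) (Fin 3) ℂ) *ᵥ v) := fun v hv ↦ by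
    rw [Units.val_one, Matrix.one_mulVec]; exact hf v hv
  have h := D.formPullback₂_topFormOfClass_pull_mulVec hHD 𝔣 hI D' 𝔣' f hT (one_mem _) hf' hX' hx
  rw [h]
  funext z
  have h1 : D.frameIso 𝔣 ⟨1, one_mem _⟩ = 1 := map_one (D.frameIso 𝔣)
  rw [h1, one_smul, BallModel.Jac_one, Matrix.det_one, one_mul]

end TopForm

end UnitaryBallUniformisationDatum

end Literature.AlgebraicGeometry.ShimuraVarieties

end
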